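import Literature.AnabelianGeometry.SemiGraphs.TemperedVerticial
import HarnessLib

/-!
# [SemiAnbd] §2/§3: approximators of the profinite presentation as morphisms (Def. 2.3 pp. 24–25)

Mochizuki, *Semi-graphs of anabelioids*, Publ. RIMS **42** (2006), Def. 2.3 (i)–(ii) pp. 24–25
[cite: MochizukiSemiAnbd2006, Def 2.3 pp.24-25]: an *approximator* of `𝒢` is a morphism
`𝒢 → 𝒢'` inducing an isomorphism of underlying semi-graphs with `𝒢'` of bounded order.  The §3
rendering `ProfiniteSemiGraph.Approximator` (`TemperedVerticial.lean`) records `𝒢'` as a semi-graph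
of FINITE groups `F_v, F_e` on the same underlying semi-graph with open-kernel homomorphisms
`Π_v → F_v`, `Π_e → F_e` compatible with the branch maps up to conjugation.  This file turns such an
`A` into honest objects of the two presentations:

* `Approximator.toProfinite A : ProfiniteSemiGraph` — `𝒢'` (finite discrete groups are profinite);
* `Approximator.toHom A : Hom 𝒢 A.toProfinite` — the §3 morphism `𝒢 → 𝒢'` over the identity of
  the underlying semi-graph (continuity from the open kernels); hence, through
  `ProfiniteSemiGraph.Hom.toAnab` (`ProfiniteHomToAnab.lean`), the §2 morphism
  `𝒢.toAnab ⟶ A.toProfinite.toAnab` that the §2 notion `SemiGraphOfAnabelioids.Hom.IsApproximator`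
  speaks about (the comparison of the two notions of approximator / quasi-coherence is the sequel).
-/

noncomputable section

namespace Literature.AnabelianGeometry.SemiGraphs

open CategoryTheory
open scoped Pointwise

universe u

/-- A homomorphism with open kernel into a discrete group is continuous ("continuous (= open-kernel)
homomorphisms `Π_v → F_v`" of the approximator rendering). [cite: MochizukiSemiAnbd2006, Def 2.3(ii) p.25] -/
theorem continuous_of_isOpen_ker_of_discreteTopology {A B : Type*} [Group A] [TopologicalSpace A]
    [IsTopologicalGroup A] [Group B] [TopologicalSpace B] [DiscreteTopology B] (f : A →* B)
    (hf : IsOpen (f.ker : Set A)) : Continuous f := by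
  refine continuous_discrete_rng.2 fun b => ?_
  rw [isOpen_iff_forall_mem_open]
  intro a₀ ha₀
  refine ⟨(fun k => a₀ * k) '' (f.ker : Set A), ?_, isOpenMap_mul_left a₀ _ hf,
    ⟨1, f.ker.one_mem, mul_one a₀⟩⟩
  rintro _ ⟨k, hk, rfl⟩
  have hb : f a₀ = b := ha₀
  change f (a₀ * k) ∈ ({b} : Set B)
  rw [map_mul, (MonoidHom.mem_ker).mp hk, mul_one, hb]
  exact Set.mem_singleton b

namespace ProfiniteSemiGraph

variable {𝒢 : ProfiniteSemiGraph.{u}}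

namespace Approximator

/-- The semi-graph of FINITE (discrete, hence profinite) groups `𝒢'` of an approximator, as a
`ProfiniteSemiGraph` on the same underlying semi-graph. [cite: MochizukiSemiAnbd2006, Def 2.3(ii) p.25] -/
def toProfinite (A : 𝒢.Approximator) : ProfiniteSemiGraph.{u} where
  graph := 𝒢.graph
  Gv := A.FV
  Ge := A.FE
  topologicalSpaceV := fun _ => ⊥
  isTopologicalGroupV := fun v => by
    letI : TopologicalSpace (A.FV v) := ⊥
    haveI : DiscreteTopology (A.FV v) := ⟨rfl⟩
    infer_instance
  compactSpaceV := fun v => by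
    letI : TopologicalSpace (A.FV v) := ⊥
    haveI : DiscreteTopology (A.FV v) := ⟨rfl⟩
    exact Finite.compactSpace
  totallyDisconnectedSpaceV := fun v => by
    letI : TopologicalSpace (A.FV v) := ⊥
    haveI : DiscreteTopology (A.FV v) := ⟨rfl⟩
    infer_instance
  topologicalSpaceE := fun _ => ⊥
  isTopologicalGroupE := fun e => by
    letI : TopologicalSpace (A.FE e) := ⊥
    haveI : DiscreteTopology (A.FE e) := ⟨rfl⟩
    infer_instance
  compactSpaceE := fun e => by
    letI : TopologicalSpace (A.FE e) := ⊥
    haveI : DiscreteTopology (A.FE e) := ⟨rfl⟩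
    exact Finite.compactSpace
  totallyDisconnectedSpaceE := fun e => by
    letI : TopologicalSpace (A.FE e) := ⊥
    haveI : DiscreteTopology (A.FE e) := ⟨rfl⟩
    infer_instance
  brHom := fun b v h => by
    letI : TopologicalSpace (A.FE (𝒢.graph.edgeOf b)) := ⊥
    haveI : DiscreteTopology (A.FE (𝒢.graph.edgeOf b)) := ⟨rfl⟩
    letI : TopologicalSpace (A.FV v) := ⊥
    exact ⟨A.brF b v h, continuous_of_discreteTopology⟩

/-- The underlying semi-graph of `𝒢'` is that of `𝒢`. [cite: MochizukiSemiAnbd2006, Def 2.3(ii) p.25] -/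
@[simp] theorem toProfinite_graph (A : 𝒢.Approximator) : A.toProfinite.graph = 𝒢.graph := rfl

/-- The branch maps of `𝒢'` are the `brF` of the approximator. [cite: MochizukiSemiAnbd2006, Def 2.3(ii) p.25] -/
@[simp] theorem toProfinite_brHom_apply (A : 𝒢.Approximator) (b : 𝒢.graph.Branch)
    (v : 𝒢.graph.Vertex) (h : 𝒢.graph.abuts b = some v) (x : A.FE (𝒢.graph.edgeOf b)) :
    A.toProfinite.brHom b v h x = A.brF b v h x := rfl

/-- **The approximator as a §3 morphism `𝒢 → 𝒢'`** over the identity of the underlying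
semi-graph: vertex/edge homomorphisms `Π_v → F_v`, `Π_e → F_e` (continuous: open kernels into
discrete groups), compatible with the branch maps up to conjugation (the element `g⁻¹` for the
`g` of `A.comm`). [cite: MochizukiSemiAnbd2006, Def 2.3(ii) p.25] -/
def toHom (A : 𝒢.Approximator) : Hom 𝒢 A.toProfinite where
  base := SemiGraph.Hom.id 𝒢.graph
  hV := fun v =>
    letI : TopologicalSpace (A.FV v) := ⊥
    haveI : DiscreteTopology (A.FV v) := discreteTopology_bot _
    ⟨A.πV v, continuous_of_isOpen_ker_of_discreteTopology (A.πV v) (A.isOpen_ker_πV v)⟩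
  hE := fun e =>
    letI : TopologicalSpace (A.FE e) := ⊥
    haveI : DiscreteTopology (A.FE e) := discreteTopology_bot _
    ⟨A.πE e, continuous_of_isOpen_ker_of_discreteTopology (A.πE e) (A.isOpen_ker_πE e)⟩
  comm := fun b v h => by
    obtain ⟨g, hg⟩ := A.comm b v h
    refine ⟨g⁻¹, fun x => ?_⟩
    change A.πV v (𝒢.brHom b v h x) = g⁻¹ * A.brF b v h (A.πE _ x) * g⁻¹⁻¹
    rw [hg x, inv_inv, ← mul_assoc, ← mul_assoc, inv_mul_cancel, one_mul, mul_assoc,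
      inv_mul_cancel, mul_one]

/-- `A.toHom` lies over the identity of the underlying semi-graph. [cite: MochizukiSemiAnbd2006, Def 2.3(ii) p.25] -/
@[simp] theorem toHom_base (A : 𝒢.Approximator) : A.toHom.base = SemiGraph.Hom.id 𝒢.graph := rfl

/-- The vertex homomorphisms of `A.toHom` are the `πV`. [cite: MochizukiSemiAnbd2006, Def 2.3(ii) p.25] -/
@[simp] theorem toHom_hV_apply (A : 𝒢.Approximator) (v : 𝒢.graph.Vertex) (x : 𝒢.Gv v) :
    A.toHom.hV v x = A.πV v x := rfl

/-- The edge homomorphisms of `A.toHom` are the `πE`. [cite: MochizukiSemiAnbd2006, Def 2.3(ii) p.25] -/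
@[simp] theorem toHom_hE_apply (A : 𝒢.Approximator) (e : 𝒢.graph.Edge) (x : 𝒢.Ge e) :
    A.toHom.hE e x = A.πE e x := rfl

/-- `A.toHom` is *locally open* (§3 sense) iff ... it always IS: the images of `Π_v → F_v` in the
DISCRETE finite groups are open. [cite: MochizukiSemiAnbd2006, Def 2.2(ii) p.24] -/
theorem toHom_isLocallyOpen (A : 𝒢.Approximator) : A.toHom.IsLocallyOpen := by
  constructor
  · intro v
    letI : TopologicalSpace (A.FV v) := ⊥
    haveI : DiscreteTopology (A.FV v) := discreteTopology_bot _
    exact isOpen_discrete ((A.πV v).range : Set (A.FV v))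
  · intro e
    letI : TopologicalSpace (A.FE e) := ⊥
    haveI : DiscreteTopology (A.FE e) := discreteTopology_bot _
    exact isOpen_discrete ((A.πE e).range : Set (A.FE e))

end Approximator

end ProfiniteSemiGraph

end Literature.AnabelianGeometry.SemiGraphs

end
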